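import Summits.Parity.GeneralizedHardyLittlewood.Theses.ZDegreeToeplitzBand
import Summits.Parity.GeneralizedHardyLittlewood.Theorems.ZDegreeToeplitzBandClassSupport
import Literature.NumberTheory.LFunctions.Zhang2022.KnifeEdgeLenZDegreeShortDensePiece

/-!
# KILL-PATH LINE `dark-schur` for crux `ShortPairsSchurClose` (stmt-Parity-20430) — NOT a proof skeleton

Route `ZDegreeToeplitzBand` (Parity / GeneralizedHardyLittlewood), K2 child on the half-class C′ = `ShortPairs`.
Planner ls-knife-plan g1, 2026-08-27 (g0 SUCCESSOR (ii); hold of record 13:04:37Z, HOLD-20430.md 61f7e4b44d98fd30).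

The item is a KILL-PATH NODE: under the E₀|C′ = NULL DESIGN (the ψ-graded degree-1 cross and dual slots are DARK on
short pairs — DISPLAY #4 d9c044f56c100226, theory PASS-WITH-NOTES 11:37:13Z / crit-1 (q)-read PASS) the C′ sign test
`ShortPairsSchurClose` is EQUIVALENT to «(A) fails for all large D» (`shortPairsSchurClose_iff_notAEventually_of_dark`,
p531342): vacuous-true on that horn, FALSE on the recurrent horn (the only branch on which K2 has content). So the two
stubs below, once closed, REFUTE the item on the recurrent horn — expected fate «refuted-in-𝕄 ⇒ derived negative
PTD(ShortPairs)», class misstated-inside-C′, no repair inside C′ (CLASS-CALL v1.2 SUCCESSOR (ii)). v3 (this file): the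
kernel route to each stub is now a ONE-LINE composition of LANDED theorems — the `_piece` ports of p538281
(`crossTablePsiOn_short_zero_eventually_of_poly_piece` / `dual…`, density leg kernel p536434) — applied to the REPAIRED
K0 `InClassSideTablesPiece` (stmt-Parity-20459; the original stmt-Parity-20016 is MISSTATED as typed and HELD) and to
x₁/y₁-darkness on polynomial short pairs (OPEN, DISPLAY #4 content): `crossDarkShort_of_polyDark`,
`dualDarkShort_of_polyDark`, and the assembled conditional kill `not_shortPairsSchurClose_of_polyDark`. The stubs are
NOT prover targets on their own; the item closes (negatively, on the recurrent horn) when stmt-Parity-20459 and the two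
poly-darkness statements are kernel theorems.
-/

namespace Summit.Parity.GeneralizedHardyLittlewood.Cruxes.ShortPairsSchurClose.DarkSchur

open Literature.NumberTheory.LFunctions.Zhang2022
open Literature.NumberTheory.LFunctions.Zhang2022.KnifeEdge
open Literature.NumberTheory.LFunctions.Zhang2022.Skeleton
open Summit.Parity.GeneralizedHardyLittlewood.Theses.ZDegreeToeplitzBand

/-- STUB 1 (E₀|C′ null design, degree-1 CROSS): the ψ-graded degree-1 cross slot is dark on ALL kinked short pairs,
eventually in `c′`. Closes via `crossDarkShort_of_polyDark` below (repaired K0 + x₁-darkness on polynomial short pairs; density is kernel, p536434/p538281). -/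
theorem stub_crossDarkShort :
    ∃ c₀ : ℝ, ∀ c' : ℝ, c₀ ≤ c' → CrossTablePsiOn c' ShortPairs 1 (fun _ _ _ _ => 0) := by
  sorry

/-- STUB 2 (E₀|C′ null design, degree-1 DUAL): the ψ-graded degree-1 dual slot is dark on ALL kinked short pairs,
eventually in `c′`. Closes via `dualDarkShort_of_polyDark` below (repaired K0 + y₁-darkness on polynomial short pairs). -/
theorem stub_dualDarkShort :
    ∃ c₀ : ℝ, ∀ c' : ℝ, c₀ ≤ c' → DualCrossTablePsiOn c' ShortPairs 1 (fun _ _ _ _ => 0) := by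
  sorry

/-- THE KILL COMPOSITION (kernel-checked, no sorry): the two stubs make the crux EQUIVALENT to «(A) fails eventually». -/
theorem shortPairsSchurClose_iff_of_stubs
    (hX : ∃ c₀ : ℝ, ∀ c' : ℝ, c₀ ≤ c' → CrossTablePsiOn c' ShortPairs 1 (fun _ _ _ _ => 0))
    (hY : ∃ c₀ : ℝ, ∀ c' : ℝ, c₀ ≤ c' → DualCrossTablePsiOn c' ShortPairs 1 (fun _ _ _ _ => 0)) :
    ShortPairsSchurClose ↔ ForAllLarge (fun D _ χ => ¬ AssumptionA D χ) :=
  Summit.Parity.GeneralizedHardyLittlewood.Theorems.shortPairsSchurClose_iff_notAEventually_of_dark hX hY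

/-- … hence on the RECURRENT horn (¬ «(A) fails eventually», the branch where K2 `PsiGradedTablesClose` has content)
the crux is FALSE: `ShortPairsSchurClose_false_without_darkLongSlot` in the Disproof idiom — any proof of the crux must
make a degree-1 short slot LIVE, which DISPLAY #4 denies modulo K0. -/
theorem not_shortPairsSchurClose_of_stubs
    (hX : ∃ c₀ : ℝ, ∀ c' : ℝ, c₀ ≤ c' → CrossTablePsiOn c' ShortPairs 1 (fun _ _ _ _ => 0))
    (hY : ∃ c₀ : ℝ, ∀ c' : ℝ, c₀ ≤ c' → DualCrossTablePsiOn c' ShortPairs 1 (fun _ _ _ _ => 0))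
    (hrec : ¬ ForAllLarge (fun D _ χ => ¬ AssumptionA D χ)) :
    ¬ ShortPairsSchurClose :=
  fun h => hrec ((shortPairsSchurClose_iff_of_stubs hX hY).mp h)

/-- … and on the other horn it holds vacuously (its own hypothesis is contradicted) — so the item is never
«refuted outright», only refuted-on-the-recurrent-horn = summit-branch-equivalent. -/
theorem shortPairsSchurClose_of_notAEventually (hA : ForAllLarge (fun D _ χ => ¬ AssumptionA D χ)) :
    ShortPairsSchurClose :=
  fun h => absurd hA h

/-! ## How the stubs close (kernel compositions over the REPAIRED K0; every input OPEN)

K0 of record is the REPAIRED item `InClassSideTablesPiece` (stmt-Parity-20459: `∃ c₀, ∀ c′ ≥ c₀, KnifeEdge.InClassMeanPiece c′`,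
p535985; route rev 7) — the original `InClassSideTables` (stmt-Parity-20016) is MISSTATED as typed (K0-MISSTATED.md
9d6c912d0fab6a8c) and HELD. Each stub is then the landed `_piece` port (p538281 `KnifeEdgeLenZDegreeShortDensePiece`, whose
density leg `shortPairs_dense_of_poly` is KERNEL, p536434) applied to: the repaired K0 + darkness of the degree-1 cross (resp. dual)
slot on ANY sub-class `𝒞₀ ⊇ PolyShortPairs`, eventually in `c′` (allowed to use the repaired K0 at `c′`) — the latter is the
DISPLAY #4 (x₁, y₁) content, OPEN, in existing vocabulary. So the kill path of stmt-Parity-20430 on the recurrent horn needs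
exactly: stmt-Parity-20459 + «x₁ dark on polynomial short pairs» + «y₁ dark on polynomial short pairs». -/

/-- The misstated K0 implies the repaired one (nothing proved over the old slot is lost). Below, the repaired K0 is
spelled by its BODY `∃ c₀, ∀ c′ ≥ c₀, InClassMeanPiece c′` (= `InClassSideTablesPiece`, stmt-Parity-20459, route file :556,
by `rfl`), so that this workfile elaborates on farm nodes still serving the pre-rev-7 build of the route module. -/
theorem inClassSideTablesPiece_of_old (h : InClassSideTables) :
    ∃ c₀ : ℝ, ∀ c' : ℝ, c₀ ≤ c' → InClassMeanPiece c' :=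
  inClassMeanPiece_eventually_of_inClassMean h

/-- `stub_crossDarkShort` ⇐ repaired K0 + x₁-darkness on a class `𝒞₀ ⊇ PolyShortPairs` (eventually, given K0 at `c′`). -/
theorem crossDarkShort_of_polyDark {𝒞₀ : PairClass}
    (h𝒞₀ : ∀ f f' g g', PolyShortPairs f f' g g' → 𝒞₀ f f' g g') (hK0 : ∃ c₀ : ℝ, ∀ c' : ℝ, c₀ ≤ c' → InClassMeanPiece c')
    (hdark : ∃ c₀ : ℝ, ∀ c' : ℝ, c₀ ≤ c' → InClassMeanPiece c' → CrossTablePsiOn c' 𝒞₀ 1 (fun _ _ _ _ => 0)) :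
    ∃ c₀ : ℝ, ∀ c' : ℝ, c₀ ≤ c' → CrossTablePsiOn c' ShortPairs 1 (fun _ _ _ _ => 0) :=
  crossTablePsiOn_short_zero_eventually_of_poly_piece h𝒞₀ hK0 hdark

/-- `stub_dualDarkShort` ⇐ repaired K0 + y₁-darkness on a class `𝒞₀ ⊇ PolyShortPairs` (eventually, given K0 at `c′`). -/
theorem dualDarkShort_of_polyDark {𝒞₀ : PairClass}
    (h𝒞₀ : ∀ f f' g g', PolyShortPairs f f' g g' → 𝒞₀ f f' g g') (hK0 : ∃ c₀ : ℝ, ∀ c' : ℝ, c₀ ≤ c' → InClassMeanPiece c')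
    (hdark : ∃ c₀ : ℝ, ∀ c' : ℝ, c₀ ≤ c' → InClassMeanPiece c' → DualCrossTablePsiOn c' 𝒞₀ 1 (fun _ _ _ _ => 0)) :
    ∃ c₀ : ℝ, ∀ c' : ℝ, c₀ ≤ c' → DualCrossTablePsiOn c' ShortPairs 1 (fun _ _ _ _ => 0) :=
  dualCrossTablePsiOn_short_zero_eventually_of_poly_piece h𝒞₀ hK0 hdark

/-- THE CONDITIONAL KILL, assembled (kernel, no sorry): repaired K0 + x₁/y₁-darkness on polynomial short pairs + recurrence of
(A)-characters ⇒ `¬ ShortPairsSchurClose`. -/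
theorem not_shortPairsSchurClose_of_polyDark {𝒞₀ 𝒞₀' : PairClass}
    (h𝒞₀ : ∀ f f' g g', PolyShortPairs f f' g g' → 𝒞₀ f f' g g')
    (h𝒞₀' : ∀ f f' g g', PolyShortPairs f f' g g' → 𝒞₀' f f' g g') (hK0 : ∃ c₀ : ℝ, ∀ c' : ℝ, c₀ ≤ c' → InClassMeanPiece c')
    (hdarkX : ∃ c₀ : ℝ, ∀ c' : ℝ, c₀ ≤ c' → InClassMeanPiece c' → CrossTablePsiOn c' 𝒞₀ 1 (fun _ _ _ _ => 0))
    (hdarkY : ∃ c₀ : ℝ, ∀ c' : ℝ, c₀ ≤ c' → InClassMeanPiece c' → DualCrossTablePsiOn c' 𝒞₀' 1 (fun _ _ _ _ => 0))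
    (hrec : ¬ ForAllLarge (fun D _ χ => ¬ AssumptionA D χ)) : ¬ ShortPairsSchurClose :=
  not_shortPairsSchurClose_of_stubs (crossDarkShort_of_polyDark h𝒞₀ hK0 hdarkX) (dualDarkShort_of_polyDark h𝒞₀' hK0 hdarkY) hrec

end Summit.Parity.GeneralizedHardyLittlewood.Cruxes.ShortPairsSchurClose.DarkSchur

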